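import Mathlib
import HarnessLib
import Summits.HubbardSuperconductivity.HubbardSuperconductivity.Theorems.KLProgrammeKLRegimeEngineDressedAliasingDiff
import Summits.HubbardSuperconductivity.HubbardSuperconductivity.Theorems.KLProgrammeC4aTadpoleJetAssembly

/-!
# Route `KLProgramme`, crux K3 — gen-8 ENGINE-FLOW child (stmt-HubbardSuperconductivity-20437 `KLRegimeEngineV17F2`), stub (C) at `n = 0`,
# located item #22a «(C)-SCALE0-PT2», step (π2c-ii, generic half): CURVE JETS OF THE INTERPOLANT OF A SYMBOL THAT VANISHES ON THE CURVE ARE PURE ALIASING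

Seat hubbard-kl-k3c5-p1 (g13; owner of #22a).  The MIXED door of the scale-`0` reading (`…FlowReadScaleZeroMixed.twoLegRead_frameZero_of_split_certD`,
p608958) takes, for the momentum-side piece `W_b`, the value / pinning / angular jets `k ≤ 4` of `H∘γ₀`, `H = evalM (symInterp L (loc(map S W_b)))`,
along the free Fermi curve `γ₀`.  For the Hartree CHAIN `W_b := Q_c` (π2b, p613532) the localised symbol is `F∘p` with a smooth `D₄`-symmetric
`2π`-periodic continuum symbol `F = G_c∘e` that VANISHES IDENTICALLY on `γ₀` (π2c-i, p614131: `G_c(0) = 0`).  This file is the generic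
harmonic-analysis step: for ANY such `F` vanishing on a `C⁴` curve `γ`,
  `H∘γ = (H − F)∘γ`, `‖Dʲ(H − F)(q)‖ ≤ A_j := 2·3ʲ·D_F·(2/N)^{M−j−4}·4C₂` at EVERY `q` (`N = 2(L/4+1)`, `‖D^M F‖ ≤ D_F`, `M ≥ 8`, `C₂ = Σ_{k∈ℤ²}∏(1+kᵢ²)⁻¹`)
— p2's difference form of the aliasing bound (`…EngineDressedAliasingDiff.norm_iteratedFDeriv_evalM_symInterp_sub_symbol_le`) with the half-tail
dominated by c4a-1's quarter tail (`…C4aAliasingJetLemma.quarterTail_weighted_le`) — and then Faà di Bruno along `γ`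
(`…PerturbedFermiCurveCompChainStruct.abs_iteratedDeriv_comp_le_bell`): `|H(γθ)| ≤ A₀`, `|(H∘γ)^{(k)}(θ)| ≤ bell4 A D k` (`1 ≤ k ≤ 4`).
The point (memo SCALE0-PT2-SIZING §5): one never bounds `‖DʲH(γθ)‖` by `‖DʲF‖ + alias` here — the transversal jets of `F` are huge (`∝ ω₀^{-j}`)
while `F∘γ ≡ 0`; only the DIFFERENCE is small.

* `tsum_halfTail_le_quarterTail` — the half-tail family `[L/2 < |ν₀| ∨ L/2 < |ν₁|]·‖F̂♭(ν)‖(|ν₀|+|ν₁|)ʲ` is dominated by the quarter-tail family;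
* **`norm_iteratedFDeriv_evalM_symInterp_sub_symbol_le_of_deriv`** — `‖Dʲ[I_L(F∘p)](q) − DʲF(q)‖ ≤ 2·3ʲ·D_F·(2/N)^{M−j−4}·4C₂` (`j + 4 ≤ M`);
* **`abs_curveJets_evalM_symInterp_le_bell4_of_vanish`** — the value and the angular jets `k ≤ 4` of `H∘γ` when `F∘γ ≡ 0`.

Pure harmonic analysis; no definitions; nothing about the Hubbard model is asserted; nothing asserts any stub of 20437, K3 or superconductivity.
References: BGM 2006 §2.3 (2.17) [cite: BenfattoGiulianiMastropietro2006]; Boyd 2001 §4.5 Thm 19–20 [cite: Boyd2001]; Grafakos 2014 §3.3.3 [cite: Grafakos2014].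
-/

noncomputable section

namespace Summit.HubbardSuperconductivity.HubbardSuperconductivity.Theorems.EngineV8

set_option linter.dupNamespace false -- summit = problem name (single-conjunct summit), D-0017

open Real Set MeasureTheory UnitAddTorus Finset Filter Literature.MathematicalPhysics.QuantumLattice Literature.Probability.LatticeModels
open Literature.Analysis.Fourier Literature.Analysis.FunctionSpaces
open Summit.HubbardSuperconductivity.HubbardSuperconductivity.Theorems.KLRegimeSplit
open Summit.HubbardSuperconductivity.HubbardSuperconductivity.Theorems.C4a
open Summit.HubbardSuperconductivity.HubbardSuperconductivity.Theorems.PerturbedFermiCurve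

variable {L : ℕ}

/-! ## §1 Half tail ≤ quarter tail -/

/-- **The half-tail family is dominated by the quarter-tail family**, termwise and hence in sum (under order-`J` weighted summability, `j ≤ J`). -/
theorem tsum_halfTail_le_quarterTail {F : Momentum → ℝ}
    (hper : ∀ (j : Fin 2) (q : Momentum), F (q + EuclideanSpace.single j (2 * π)) = F q) {J : ℕ}
    (hw : Summable fun ν : Fin 2 → ℤ => ‖mFourierCoeff (symbolFlat F hper) ν‖ * (1 + ∑ i, |(ν i : ℝ)|) ^ J)
    {j : ℕ} (hj : j ≤ J) :
    ∑' ν : Fin 2 → ℤ, (if (L / 2 < (ν 0).natAbs ∨ L / 2 < (ν 1).natAbs) then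
        ‖mFourierCoeff (symbolFlat F hper) ν‖ * (|((ν 0 : ℤ) : ℝ)| + |((ν 1 : ℤ) : ℝ)|) ^ j else 0) ≤
      ∑' η : Fin 2 → ℤ, (if ∃ i, L / 4 < (η i).natAbs then
        ‖mFourierCoeff (symbolFlat F hper) η‖ * (1 + ∑ i : Fin 2, |((η i : ℤ) : ℝ)|) ^ j else 0) := by
  have hwt : ∀ ν : Fin 2 → ℤ, (|((ν 0 : ℤ) : ℝ)| + |((ν 1 : ℤ) : ℝ)|) ^ j ≤ (1 + ∑ i : Fin 2, |((ν i : ℤ) : ℝ)|) ^ j := fun ν => by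
    rw [Fin.sum_univ_two]
    exact pow_le_pow_left₀ (by positivity) (by linarith) j
  have hwJ : ∀ ν : Fin 2 → ℤ, (1 + ∑ i : Fin 2, |((ν i : ℤ) : ℝ)|) ^ j ≤ (1 + ∑ i : Fin 2, |((ν i : ℤ) : ℝ)|) ^ J := fun ν =>
    pow_le_pow_right₀ (by simp only [le_add_iff_nonneg_right]; positivity) hj
  have hS1 : Summable fun ν : Fin 2 → ℤ => (if (L / 2 < (ν 0).natAbs ∨ L / 2 < (ν 1).natAbs) then
      ‖mFourierCoeff (symbolFlat F hper) ν‖ * (|((ν 0 : ℤ) : ℝ)| + |((ν 1 : ℤ) : ℝ)|) ^ j else 0) := by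
    refine Summable.of_nonneg_of_le (fun ν => by positivity) (fun ν => ?_) hw
    split_ifs
    · exact mul_le_mul_of_nonneg_left ((hwt ν).trans (hwJ ν)) (norm_nonneg _)
    · positivity
  have hS2 : Summable fun η : Fin 2 → ℤ => (if ∃ i, L / 4 < (η i).natAbs then
      ‖mFourierCoeff (symbolFlat F hper) η‖ * (1 + ∑ i : Fin 2, |((η i : ℤ) : ℝ)|) ^ j else 0) := by
    refine Summable.of_nonneg_of_le (fun ν => by positivity) (fun ν => ?_) hw
    split_ifs
    · exact mul_le_mul_of_nonneg_left (hwJ ν) (norm_nonneg _)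
    · positivity
  refine Summable.tsum_le_tsum (fun ν => ?_) hS1 hS2
  by_cases h1 : L / 2 < (ν 0).natAbs ∨ L / 2 < (ν 1).natAbs
  · have h2 : ∃ i, L / 4 < (ν i).natAbs := by
      rcases h1 with h | h
      · exact ⟨0, by omega⟩
      · exact ⟨1, by omega⟩
    rw [if_pos h1, if_pos h2]
    exact mul_le_mul_of_nonneg_left (hwt ν) (norm_nonneg _)
  · rw [if_neg h1]
    split_ifs
    · positivity
    · exact le_rfl

/-! ## §2 The difference aliasing bound from a top-order derivative bound -/

/-- **`‖Dʲ[evalM (symInterp L (F∘p))](q) − DʲF(q)‖ ≤ 2·3ʲ·D_F·(2/N)^{M−j−4}·4C₂`** for a smooth `D₄`-symmetric `2π`-periodic `F` with `‖D^M F‖ ≤ D_F`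
(`4 + j ≤ M`, `N = 2(L/4+1)`, `C₂ = Σ_{k∈ℤ²}∏ᵢ(1+kᵢ²)⁻¹`), at EVERY continuum momentum `q`. -/
theorem norm_iteratedFDeriv_evalM_symInterp_sub_symbol_le_of_deriv [NeZero L] {F : Momentum → ℝ}
    (hper : ∀ (j : Fin 2) (q : Momentum), F (q + EuclideanSpace.single j (2 * π)) = F q) (hF : ContDiff ℝ (⊤ : ℕ∞) F)
    (hrefl : ∀ p : Fin 2 → ℝ, F (WithLp.toLp 2 ![p 0, -p 1]) = F (WithLp.toLp 2 p))
    (hswap : ∀ p : Fin 2 → ℝ, F (WithLp.toLp 2 ![p 1, p 0]) = F (WithLp.toLp 2 p)) {Mdeg : ℕ} {DF : ℝ}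
    (hDF : ∀ q : Momentum, ‖iteratedFDeriv ℝ Mdeg F q‖ ≤ DF) {j : ℕ} (hj : 4 + j ≤ Mdeg) (q : Momentum) :
    ‖iteratedFDeriv ℝ j (evalM (symInterp L (fun k : TorusSite 2 L => F (WithLp.toLp 2 (latticeMomentum L k))))) q -
        iteratedFDeriv ℝ j F q‖ ≤
      2 * ((3 : ℝ) ^ j * DF * (2 / ((2 * (L / 4 + 1) : ℕ) : ℝ)) ^ (Mdeg - j - 4) * (2 ^ 2 * ∑' k : Fin 2 → ℤ, ∏ i, (1 + (k i : ℝ) ^ 2)⁻¹)) := by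
  have hflat := norm_partialDeriv_iterate_symbolFlat_le hper hF hDF
  have hw := summable_weighted_symbolFlat_of_deriv hper hF (M := Mdeg) (J := Mdeg - 4) (by omega) hflat
  have h1 := norm_iteratedFDeriv_evalM_symInterp_sub_symbol_le (L := L) hper hF hrefl hswap hw (j := j) (by omega) q
  have h2 := tsum_halfTail_le_quarterTail (L := L) hper hw (j := j) (by omega)
  have h3 := quarterTail_weighted_le (L := L) hper hF hj hflat
  have hπ : (2 * π) ^ Mdeg * DF / (2 * π) ^ Mdeg = DF := by
    rw [mul_comm, mul_div_assoc, div_self (by positivity), mul_one]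
  rw [hπ] at h3
  linarith

/-! ## §3 Curve jets of the interpolant of a symbol vanishing on the curve -/

/-- **CURVE JETS OF THE INTERPOLANT OF A SYMBOL VANISHING ON THE CURVE ARE PURE ALIASING.**  `F` smooth, `2π`-periodic, `D₄`-symmetric,
`‖D^M F‖ ≤ D_F` (`M ≥ 8`); `γ` a `C⁴` curve with `‖γ^{(i)}‖ ≤ D i` (`1 ≤ i ≤ 4`) on which `F` VANISHES; `A j` any majorants of the aliasing
constants `2·3ʲ·D_F·(2/N)^{M−j−4}·4C₂` (`j ≤ 4`).  Then for `H = evalM (symInterp L (F∘p))`: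
`|H(γθ)| ≤ A 0` and `|(H∘γ)^{(k)}(θ)| ≤ bell4 A D k` for `1 ≤ k ≤ 4`. -/
theorem abs_curveJets_evalM_symInterp_le_bell4_of_vanish [NeZero L] {F : Momentum → ℝ}
    (hper : ∀ (j : Fin 2) (q : Momentum), F (q + EuclideanSpace.single j (2 * π)) = F q) (hF : ContDiff ℝ (⊤ : ℕ∞) F)
    (hrefl : ∀ p : Fin 2 → ℝ, F (WithLp.toLp 2 ![p 0, -p 1]) = F (WithLp.toLp 2 p))
    (hswap : ∀ p : Fin 2 → ℝ, F (WithLp.toLp 2 ![p 1, p 0]) = F (WithLp.toLp 2 p)) {Mdeg : ℕ} (hM : 8 ≤ Mdeg) {DF : ℝ}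
    (hDF : ∀ q : Momentum, ‖iteratedFDeriv ℝ Mdeg F q‖ ≤ DF)
    {γ : ℝ → Momentum} (hγ : ContDiff ℝ 4 γ) {D : ℕ → ℝ} (hD : ∀ θ : ℝ, ∀ i, 1 ≤ i → i ≤ 4 → ‖iteratedDeriv i γ θ‖ ≤ D i)
    (hFγ : ∀ θ, F (γ θ) = 0) {A : ℕ → ℝ}
    (hA : ∀ j ≤ 4, 2 * ((3 : ℝ) ^ j * DF * (2 / ((2 * (L / 4 + 1) : ℕ) : ℝ)) ^ (Mdeg - j - 4) *
      (2 ^ 2 * ∑' k : Fin 2 → ℤ, ∏ i, (1 + (k i : ℝ) ^ 2)⁻¹)) ≤ A j) (θ : ℝ) :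
    |evalM (symInterp L (fun k : TorusSite 2 L => F (WithLp.toLp 2 (latticeMomentum L k)))) (γ θ)| ≤ A 0 ∧
      ∀ k, 1 ≤ k → k ≤ 4 →
        |iteratedDeriv k (fun θ : ℝ => evalM (symInterp L (fun k : TorusSite 2 L => F (WithLp.toLp 2 (latticeMomentum L k)))) (γ θ)) θ| ≤
          bell4 A D k := by
  set H : Momentum → ℝ := evalM (symInterp L (fun k : TorusSite 2 L => F (WithLp.toLp 2 (latticeMomentum L k)))) with hH
  have hHc : ContDiff ℝ (⊤ : ℕ∞) H := contDiff_evalM _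
  -- the difference and its jets at every point
  have hdiff : ∀ j ≤ 4, ∀ q : Momentum, ‖iteratedFDeriv ℝ j (H - F) q‖ ≤ A j := fun j hj q => by
    rw [iteratedFDeriv_sub_apply (hHc.of_le (by exact_mod_cast le_top)).contDiffAt (hF.of_le (by exact_mod_cast le_top)).contDiffAt]
    exact (norm_iteratedFDeriv_evalM_symInterp_sub_symbol_le_of_deriv hper hF hrefl hswap hDF (j := j) (by omega) q).trans (hA j hj)
  -- along the curve the interpolant IS the difference
  have hcomp : (fun θ : ℝ => H (γ θ)) = (H - F) ∘ γ := by
    funext θ'; simp [hFγ θ']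
  have hH4 : ContDiff ℝ 4 H := contDiff_evalM _
  have hF4 : ContDiff ℝ 4 F := hF.of_le (by exact WithTop.coe_le_coe.mpr le_top)
  have hGc : ContDiff ℝ 4 (H - F) := hH4.sub hF4
  refine ⟨?_, fun k hk1 hk4 => ?_⟩
  · have h0 := hdiff 0 (by norm_num) (γ θ)
    rw [norm_iteratedFDeriv_zero] at h0
    simpa [hFγ θ] using h0
  · rw [hcomp]
    obtain ⟨h1, h2, h3, h4⟩ := abs_iteratedDeriv_comp_le_bell (F := H - F) (γ := γ) hGc hγ (θ := θ) (M := A) (D := D)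
      (fun k hk1 hk4 => hdiff k hk4 _) (hD θ)
    interval_cases k
    · simpa [bell4] using h1
    · simpa [bell4] using h2
    · simpa [bell4] using h3
    · simpa [bell4] using h4

end Summit.HubbardSuperconductivity.HubbardSuperconductivity.Theorems.EngineV8

end
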